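import Summits.HodgeConjecture.HodgeConjecture.Theorems.BiquadraticSecantLiftTwelvefoldHOne
import HarnessLib

/-!
# BiquadraticSecantLift · X2 — `(⨁_{Fin 2} A, η)` is of Weil type relative to the biquadratic CM field
# `E = ℚ[T]/(R_(d,m)(T²)) = ℚ(√-d, √m)` (Deligne's (4.4): `IsWeilTypeCM (twelvefold A) (etaTwo A φ m) (bqPoly d m) 2 3`)

Helper file for crux X2 `BiquadraticBaseChangeHyperbolic` (stmt-HodgeConjecture-22133) of
route-HodgeConjecture-BiquadraticSecantLift; part 2, sequel of `…TwelvefoldHOne` (graphs `J_λ`, eigenspaces of `η^*`,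
multiplicities). For a complex abelian SIXFOLD `A` with `φ ≫ φ = -d` (`d ≥ 1`) of Weil type `(3, 3)` relative to
`K = ℚ(φ)` (`Deligne1982.IsWeilTypeCM A φ (S + d) 1 3` ⟸ a non-zero `(3,3)` class in the Weil plane,
`isWeilTypeCM_quadratic_of_weilClass`) and `m ≥ 1` not a square, the twelvefold `B = ⨁_{Fin 2} A` with
`η = (φ ⊕ φ) ≫ (𝟙 + ψ_m)` is of Weil type relative to `L = ℚ(η) ≅ ℚ[T]/(R_(d,m)(T²))`, `e₀ = 2`, `k = 3`
(`isWeilTypeCM_twelvefold`, Deligne's point `A ⊗_K L` of the proof of Thm. 4.8): `R_(d,m)((η^*)²) = 0` on `H¹(B)`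
(`(η^*)² = -d(1+λ)²` on `J_λ H¹(A)`), hence `R_(d,m)(η²) = 0` in `End B` by faithfulness of `End B → End H¹(B)`;
`dim B = 12 = 2·3·2`; the algebraic clauses are those of `…BaseChangePoly`. Nothing here is a case of the Hodge conjecture
(HC is NOT proved; X2 is not proved by this file).

## References
[cite: Deligne1982HodgeCycles, §4 (4.4), Prop. 4.4, proof of Thm. 4.8 (a)–(b) (re-edition pp. 32–34), §5 p. 55]
[cite: MoonenZarhin1998WeilClasses, §1 (6)] [cite: LangeBirkenhake1992, §1.1 (p. 19)]
-/

-- every declaration of this problem lives in `Summit.HodgeConjecture.HodgeConjecture.…` (summit = sub-problem)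
set_option linter.dupNamespace false

noncomputable section

open CategoryTheory CategoryTheory.Limits Polynomial Module
open Literature.AlgebraicTopology.SingularHomology
open Literature.AlgebraicGeometry.HodgeTheory
open Literature.AlgebraicGeometry.Motives (AbelianVariety IsSmoothProjective)
open Literature.AlgebraicGeometry.Deligne1982
open Literature.AlgebraicGeometry.Pohlmann1968 (sum_map_π_map_ι map_ι_map_π_self map_ι_map_π_ne map_biproductMap_map_π)

namespace Summit.HodgeConjecture.HodgeConjecture.BiquadraticSecantLift

variable {A : AbelianVariety ℂ} {φ : A ⟶ A} {d m : ℕ}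

/-! ## §3 `R_(d,m)(η²) = 0` in `End(⨁_{Fin 2} A)` and the dimension -/

section Relations

/-- **`R_(d,m)((η^*)²) = 0` on `H¹(⨁_{Fin 2} A)`**: on the graph `J_λ H¹(A)` (`λ = ±√m`) the operator `(η^*)²` is the
scalar `-d(1+λ)²`, a root of `R_(d,m)`, and `H¹ = J_{√m} H¹(A) + J_{-√m} H¹(A)`. -/
theorem aeval_etaTwo_bqPoly_comp_eq_zero (hφ : φ ≫ φ = -(d • 𝟙 A)) (hm : ¬ IsSquare m) :
    Polynomial.aeval (complexBetti.map (etaTwo A φ m).hom.hom.hom 1).hom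
      (((bqPoly d m).comp (X ^ 2)).map (Int.castRingHom ℂ)) = 0 := by
  set T := (complexBetti.map (etaTwo A φ m).hom.hom.hom 1).hom with hT
  have hsq : ((Real.sqrt m : ℝ) : ℂ) ^ 2 = (m : ℂ) := by rw [sq]; exact sqrt_mul_sqrt_natCast m
  have hs0 : ((Real.sqrt m : ℝ) : ℂ) ≠ 0 := by
    intro h0
    rw [h0, zero_pow two_ne_zero] at hsq
    exact (Nat.cast_ne_zero.2 (ne_zero_of_not_isSquare hm)) hsq.symm
  -- on a graph `J_λ a`, `T² = -d(1+λ)²`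
  have key : ∀ (lam : ℂ), (lam = (Real.sqrt m : ℂ) ∨ lam = -(Real.sqrt m : ℂ)) → ∀ a : complexBetti A.X 1,
      Polynomial.aeval T (((bqPoly d m).comp (X ^ 2)).map (Int.castRingHom ℂ))
        (complexBetti.map (biproduct.π (fun _ : Fin 2 => A) 0).hom.hom.hom 1 a +
          lam • complexBetti.map (biproduct.π (fun _ : Fin 2 => A) 1).hom.hom.hom 1 a) = 0 := by
    intro lam hlam a
    have hlam2 : lam ^ 2 = (m : ℂ) := sq_eq_of_sqrt_sign hlam
    set v := complexBetti.map (biproduct.π (fun _ : Fin 2 => A) 0).hom.hom.hom 1 a +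
      lam • complexBetti.map (biproduct.π (fun _ : Fin 2 => A) 1).hom.hom.hom 1 a with hv
    have hT2 : (T ^ 2) v = (-((d : ℂ) * (1 + lam) ^ 2)) • v := by
      rw [sq, Module.End.mul_apply]
      change complexBetti.map (etaTwo A φ m).hom.hom.hom 1 (complexBetti.map (etaTwo A φ m).hom.hom.hom 1 v) = _
      rw [hv, map_etaTwo_graph A hlam2, map_smul, map_etaTwo_graph A hlam2, complexBetti_map_map_one_of_comp_self hφ,
        map_neg, map_smul, map_neg, map_smul, smul_smul]
      module
    rw [Polynomial.map_comp, Polynomial.map_pow, Polynomial.map_X, Polynomial.aeval_comp, Polynomial.aeval_X_pow]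
    by_cases hv0 : v = 0
    · rw [hv0, map_zero]
    rw [Module.End.aeval_apply_of_hasEigenvector ⟨Module.End.mem_eigenspace_iff.2 hT2, hv0⟩, Polynomial.eval_map,
      bqPoly_eq, bq_eval₂_eq_mul, Complex.ofReal_sub, Complex.ofReal_add, Complex.ofReal_one]
    rcases hlam with rfl | rfl
    · rw [show -((d : ℂ) * (1 + (Real.sqrt m : ℂ)) ^ 2) + (d : ℂ) * (1 + (Real.sqrt m : ℂ)) ^ 2 = 0 by ring,
        mul_zero, zero_smul]
    · rw [show -((d : ℂ) * (1 + -(Real.sqrt m : ℂ)) ^ 2) + (d : ℂ) * (1 - (Real.sqrt m : ℂ)) ^ 2 = 0 by ring,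
        zero_mul, zero_smul]
  refine LinearMap.ext fun w => ?_
  obtain ⟨a, b, hw⟩ := exists_graph_decomposition A hs0 w
  rw [LinearMap.zero_apply, hw, map_add, key _ (Or.inl rfl) a, key _ (Or.inr rfl) b, add_zero]

/-- **`R_(d,m)(η²) = 0` in `End(⨁_{Fin 2} A)`** (the representation of `End` on `H¹` is faithful). -/
theorem eval₂_End_etaTwo_bqPoly_comp_eq_zero (hφ : φ ≫ φ = -(d • 𝟙 A)) (hm : ¬ IsSquare m) :
    Polynomial.eval₂ (Int.castRingHom (CategoryTheory.End (twelvefold A))) (etaTwo A φ m : CategoryTheory.End (twelvefold A))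
      ((bqPoly d m).comp (X ^ 2)) = 0 := by
  have h := hom_complexBetti_map_eval₂_one (etaTwo A φ m) ((bqPoly d m).comp (X ^ 2))
  rw [aeval_etaTwo_bqPoly_comp_eq_zero hφ hm] at h
  exact Literature.AlgebraicGeometry.ComplexMultiplication.hom_eq_zero_of_complexBetti_map_one_eq_zero _ h

/-- `dim (⨁_{Fin 2} A) = 2 · dim A`. -/
theorem dim_twelvefold (A : AbelianVariety ℂ) : (twelvefold A).dim = A.dim + A.dim := by
  change (⨁ (fun _ : Fin 2 => A)).dim = _
  rw [Literature.AlgebraicGeometry.Milne1999.dim_biproduct_succ]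
  congr 1
  exact (Literature.AlgebraicGeometry.Motives.AbelianVariety.dim_eq_of_isIsogeny
    (Literature.AlgebraicGeometry.Milne1999.isIsogeny_biproduct_π_fin_one (fun _ : Fin 1 => A)))

end Relations

/-! ## §4 The Weil-type CM datum `(⨁_{Fin 2} A, η, R_(d,m), e₀ = 2, k = 3)` -/

section WeilType

/-- **`A` is a `K = ℚ(√-d)`-Weil sixfold in Deligne's sense** from the route's hypotheses: `dim A = 6`, `φ ≫ φ = -d`
(`d ≥ 1`) and a NON-ZERO class of Hodge type `(3,3)` in the Weil plane `weilClassesOf A φ 3 d` force multiplicity `3`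
of `i√d` on `H^{1,0}(A)` (van Geemen 4.10 / Deligne–Milne Prop. 4.4, the tree's `isWeilType_of_weilClass_ne_zero`),
i.e. `IsWeilTypeCM A φ (S + d) 1 3`. -/
theorem isWeilTypeCM_quadratic_of_weilClass (hd : 0 < d) (hA : A.dim = 2 * 3) (hφ : φ ≫ φ = -(d • 𝟙 A))
    (hw : ∃ w : complexBetti A.X (2 * 3), w ∈ weilClassesOf A φ 3 d ∧ w ≠ 0 ∧ IsOfHodgeType (2 * 3) A.X (2 * 3) 3 3 w) :
    IsWeilTypeCM A φ (X + C (d : ℤ)) 1 3 := by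
  obtain ⟨w, hwW, hw0, hwH⟩ := hw
  exact isWeilTypeCM_quadratic_iff.2 (isWeilType_of_weilClass_ne_zero (by norm_num) hd hA hφ hwW hw0 hwH)

/-- **`(⨁_{Fin 2} A, η = (φ ⊕ φ) ≫ (𝟙 + ψ_m))` is of Weil type relative to the biquadratic CM field
`L = ℚ[T]/(R_(d,m)(T²)) = ℚ(√-d, √m)`, with `e₀ = 2`, `k = 3`** — Deligne's point `A ⊗_K L` for a `K`-Weil sixfold
`(A, φ)` and `m ≥ 1` not a square. -/
theorem isWeilTypeCM_twelvefold (hWA : IsWeilTypeCM A φ (X + C (d : ℤ)) 1 3) (hm : ¬ IsSquare m) :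
    IsWeilTypeCM (twelvefold A) (etaTwo A φ m) (bqPoly d m) 2 3 := by
  have hWA' := isWeilTypeCM_quadratic_iff.1 hWA
  have hd : 0 < d := hWA'.d_pos
  have hφ : φ ≫ φ = -(d • 𝟙 A) := hWA'.sq_eq
  have hdC : (d : ℂ) ≠ 0 := Nat.cast_ne_zero.2 hd.ne'
  refine
    { e₀_pos := two_pos
      k_pos := three_pos
      monic := bq_monic d m
      natDegree_eq := bq_natDegree d m
      irreducible := bq_comp_irreducible hd hm
      root_real_neg := bq_root_real_neg hd hm
      eval₂_eq_zero := eval₂_End_etaTwo_bqPoly_comp_eq_zero hφ hm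
      dim_eq := by rw [dim_twelvefold, hWA'.dim_eq]
      multiplicity_eq := fun ρ hρ => ?_ }
  obtain ⟨μ, lam, hμ, hlam, rfl⟩ := bq_comp_root_eq ρ hρ
  obtain ⟨h1l', h1l⟩ := one_add_ne_zero_of_sqrt_sign hm hlam
  have hlam0 : lam ≠ 0 := by
    intro h0
    have h2 := sq_eq_of_sqrt_sign hlam
    rw [h0, zero_pow two_ne_zero] at h2
    exact (Nat.cast_ne_zero.2 (ne_zero_of_not_isSquare hm)) h2.symm
  rw [eigenMultiplicity_etaTwo hφ hdC (sq_eq_neg_of_root_sign hμ) (sq_eq_of_sqrt_sign hlam) hlam0 h1l h1l']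
  refine hWA.multiplicity_eq μ ?_
  rw [X_add_C_comp_X_sq, eval₂_X_sq_add_C_eq_zero_iff]
  exact hμ

/-- **The route's form**: for `d ≥ 1`, a sixfold `(A, φ)` with `φ ≫ φ = -d` carrying a non-zero `(3,3)` class in its
Weil plane, and `m` not a square, `(⨁_{Fin 2} A, etaTwo A φ m)` is a Weil-type CM datum for `(R_(d,m), 2, 3)`. -/
theorem isWeilTypeCM_twelvefold_of_weilClass (hd : 0 < d) (hA : A.dim = 2 * 3) (hφ : φ ≫ φ = -(d • 𝟙 A))
    (hw : ∃ w : complexBetti A.X (2 * 3), w ∈ weilClassesOf A φ 3 d ∧ w ≠ 0 ∧ IsOfHodgeType (2 * 3) A.X (2 * 3) 3 3 w)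
    (hm : ¬ IsSquare m) :
    IsWeilTypeCM (twelvefold A) (etaTwo A φ m) (bqPoly d m) 2 3 :=
  isWeilTypeCM_twelvefold (isWeilTypeCM_quadratic_of_weilClass hd hA hφ hw) hm

end WeilType

end Summit.HodgeConjecture.HodgeConjecture.BiquadraticSecantLift
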